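import Summits.HodgeConjecture.CorCM.MultiFieldWeilStabiliserTransfer
import HarnessLib

/-!
# MULTI-FIELD WEIL ENGINE — THE DEFECT LAW SLOT BY SLOT: after the stabiliser-transitive transfer each slot is moved ALONE through its full image, so a
# SEPARATING slot image suffices — prime size (any proper position set), ONE-member position sets (any size), or `p`-HOMOGENEOUS images (e.g. `2`-transitive
# quartic parts for `(2,2)`-octics); no primality of the relative degrees

Cell `pub-hodgecm2` (COR-CM), seat b30 gen 38 (2026-08-25); count-neutral own lane MULTI-FIELD WEIL ENGINE (stem `MultiFieldWeil*`), census level (the finite model of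
`Census/MultiFieldWeil*`, abstract tuple sets `R ⊆ ∏_m Sym(n_m)`), sequel of `CorCM/MultiFieldWeilStabiliserTransfer.lean` (V1: the stabiliser-transitive transfer
`signed_transfer` and the defect law for PRIME slots `exists_hasDefectsG_of_stabiliserTransitive`).  Theorems only; no definition, no named fact, no `sorry`, no
`decide`.  HONEST FRAMING: pure finite combinatorics; `HC_CM` is NOT touched.

THE POINT.  V1 transfers the signed equations `u + Σ_m E_m(π_m) = 0` from the realised tuples `R` to the PRODUCT `R⁺ = ∏_m G_m` of the slot images (under
stabiliser-transitivity), and then peels the slots by the prime tower — which needs every `n_m` PRIME (a pure rotation per slot).  But in `R⁺` every slot is moved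
ALONE through its whole image `G_m`: comparing the equation at `(1, …, σ, …, 1)` with the one at `1` gives `Σ_{a ∈ σ⁻¹P_m} d_m(a) = Σ_{a ∈ P_m} d_m(a)` for EVERY
`σ ∈ G_m` (§1 `sum_preG_eq_of_signed_update`).  So the defect `d_m` is constant as soon as the slot image SEPARATES the position set (§2
**`exists_hasDefectsG_of_stabiliserTransitive_sep`**: the defect law under stabiliser-transitivity and a slot-wise separation hypothesis `hsep`, NO primality), and
`hsep` holds for (§3):
* `sep_of_prime_slot` — `n_m` PRIME, `0 < |P_m| < n_m` (a transitive image of prime degree contains an `n_m`-cycle: V1's route, now one slot at a time);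
* `sep_of_card_one` — `|P_m| = 1`, ANY size (the image is transitive: all singletons occur) — e.g. `(1,3)`-types over OCTIC fields;
* `sep_of_homogeneous` — `0 < |P_m| < n_m` and every `|P_m|`-subset is some `σ⁻¹P_m` (`|P_m|`-homogeneous image; `sep_of_powersetCard`), with
  `homogeneous_two_of_twoTransitive` — ordered `2`-transitivity gives `2`-homogeneity — e.g. `(2,2)`-types over OCTIC fields with quartic part `𝔄₄` or `𝔖₄`.
§4 reads §2–§3 on the realised tuples (`exists_hasDefectsG_realisedTuples_of_stabiliserTransitive_sep`, per-slot menu `hkind`): the input `hdef` of the engine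
`hodgeConjectureFor_biproduct_comp_of_defectLawG` for families mixing sextic, OCTIC and decic CM fields through `k` (consumer: the octic-slot headline, sequel).

[cite: MoonenZarhin1995Duke, Thm. 2.4] [cite: Pohlmann1968, Thm 1] [cite: GaoUllmo2025, Thm 3.1] [cite: DixonMortimer1996, §1.6 Thm. 1.6A, §2.1]

## References
* [MoonenZarhin1995Duke] B. Moonen, Yu. Zarhin, Duke Math. J. 77 (1995), Thm. 2.4.  [Pohlmann1968] H. Pohlmann, Ann. of Math. 88 (1968), Thm 1.  [GaoUllmo2025] Z. Gao, E. Ullmo,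
  J. Inst. Math. Jussieu 25 (2025), Thm 3.1.  [DixonMortimer1996] J. D. Dixon, B. Mortimer, *Permutation Groups*, GTM 163, §1.6 (Thm. 1.6A), §2.1.
-/

noncomputable section

namespace Summit.HodgeConjecture.CorCM.MultiFieldWeil

open Finset
open Summit.HodgeConjecture.CorCM.Census.MultiFieldWeil

open scoped Classical

section Model

variable {r : ℕ} {n : Fin r → ℕ} {R : Finset (PermsG n)} {P : ∀ m : Fin r, Finset (Fin (n m))}

/-! ## §1 One slot moved alone: the position-set sums are invariant -/

/-- **ONE SLOT MOVED ALONE.**  If a tuple set `R'` contains `1` and the tuple `(1, …, σ, …, 1)` (`σ` at the slot `m₀`), then every solution of the signed equations at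
the tuples of `R'` has `Σ_{a ∈ σ⁻¹ P_{m₀}} d_{m₀}(a) = Σ_{a ∈ P_{m₀}} d_{m₀}(a)`: the two equations differ only in the `m₀`-term, which is `2 Σ_{σ⁻¹P} d − Σ d` resp.
`2 Σ_P d − Σ d`. [cite: MoonenZarhin1995Duke, Thm. 2.4] -/
theorem sum_preG_eq_of_signed_update {R' : Finset (PermsG n)} (h1 : (1 : PermsG n) ∈ R') {m₀ : Fin r} {σ : Equiv.Perm (Fin (n m₀))}
    (hσ : Function.update (1 : PermsG n) m₀ σ ∈ R') {e : ℤ} {d : ∀ m : Fin r, Fin (n m) → ℤ}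
    (h : ∀ π ∈ R', e + ∑ m : Fin r, ∑ a : Fin (n m), (if π m a ∈ P m then d m a else -d m a) = 0) :
    ∑ a ∈ preG σ (P m₀), d m₀ a = ∑ a ∈ P m₀, d m₀ a := by
  have hsplit : ∀ π : PermsG n, (∑ m : Fin r, ∑ a : Fin (n m), (if π m a ∈ P m then d m a else -d m a)) =
      (∑ a : Fin (n m₀), (if π m₀ a ∈ P m₀ then d m₀ a else -d m₀ a)) +
        ∑ m ∈ univ.erase m₀, ∑ a : Fin (n m), (if π m a ∈ P m then d m a else -d m a) := fun π =>
    (Finset.add_sum_erase univ (fun m => ∑ a : Fin (n m), (if π m a ∈ P m then d m a else -d m a)) (Finset.mem_univ m₀)).symm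
  have hσ' := h _ hσ
  have h1' := h _ h1
  rw [hsplit] at hσ' h1'
  have hrest : (∑ m ∈ univ.erase m₀, ∑ a : Fin (n m), (if (Function.update (1 : PermsG n) m₀ σ) m a ∈ P m then d m a else -d m a)) =
      ∑ m ∈ univ.erase m₀, ∑ a : Fin (n m), (if (1 : PermsG n) m a ∈ P m then d m a else -d m a) :=
    Finset.sum_congr rfl fun m hm => by rw [Function.update_of_ne (Finset.ne_of_mem_erase hm)]
  rw [hrest, Function.update_self, sum_ite_mem_eq_of_iff (Q := preG σ (P m₀)) (fun a => mem_preG.symm)] at hσ'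
  rw [Pi.one_apply, sum_ite_mem_eq_of_iff (Q := P m₀) (fun a => by rw [Equiv.Perm.one_apply])] at h1'
  linarith

/-! ## §2 The defect law under stabiliser-transitivity and slot-wise separation -/

/-- **THE DEFECT LAW WITHOUT PRIMALITY.**  `R ⊆ ∏_m Sym(n_m)` non-empty, closed under products and inverses, transitive on every slot and STABILISER-TRANSITIVE (for
`m₀ ≠ m` the tuples trivial at `m₀` are transitive on the slot `m`); and every slot SEPARATES its position set: a function on the slot `m` whose sums through all the
translates `(π_m)⁻¹ P_m`, `π ∈ R`, agree with its sum through `P_m` is constant (`hsep`).  Then every configuration balanced under `R` obeys the defect law with curve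
multiplicities `c_m = n_m − 2|P_m|`.  Proof: V1's `signed_transfer` to the product `R⁺` of the slot images; in `R⁺` each slot is moved alone (§1); `hsep`;
`exists_defects_of_const`. [cite: MoonenZarhin1995Duke, Thm. 2.4] [cite: Pohlmann1968, Thm 1] [cite: GaoUllmo2025, Thm 3.1] -/
theorem exists_hasDefectsG_of_stabiliserTransitive_sep (hmul : ∀ π ∈ R, ∀ π' ∈ R, π * π' ∈ R) (hinv : ∀ π ∈ R, π⁻¹ ∈ R) (hne : R.Nonempty)
    (htrans : ∀ (m : Fin r) (a a' : Fin (n m)), ∃ π ∈ R, π m a = a')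
    (hstab : ∀ (m₀ m : Fin r), m₀ ≠ m → ∀ a a' : Fin (n m), ∃ ν ∈ R, ν m₀ = 1 ∧ ν m a = a')
    (hsep : ∀ (m : Fin r) (f : Fin (n m) → ℤ), (∀ π ∈ R, ∑ a ∈ preG (π m) (P m), f a = ∑ a ∈ P m, f a) → ∀ a b : Fin (n m), f a = f b)
    (c : Fin r → ℕ) (hc : ∀ m, ((c m : ℕ) : ℤ) = (n m : ℤ) - 2 * (P m).card)
    {α : Type} (v : α → PtG n) (T : Finset α) (hT : ModelBalancedG P R v T) : ∃ t : Fin r → ℤ, HasDefectsG c v T t := by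
  have h1R : (1 : PermsG n) ∈ R := one_mem_of_closed hmul hinv hne
  -- the product of the slot images
  set R' : Finset (PermsG n) := Finset.univ.filter fun π' => ∀ m, ∃ π ∈ R, π m = π' m with hR'
  have hmemR' : ∀ π' : PermsG n, π' ∈ R' ↔ ∀ m, ∃ π ∈ R, π m = π' m := fun π' => by simp [hR']
  have hRR' : R ⊆ R' := fun π hπ => (hmemR' π).2 fun m => ⟨π, hπ, rfl⟩
  have h1R' : (1 : PermsG n) ∈ R' := hRR' h1R
  have hne' : R'.Nonempty := hne.mono hRR'
  -- the signed equations at `R`, transferred to `R'`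
  have hsig : ∀ π ∈ R', (((cnt v T (Sum.inl true)) : ℤ) - cnt v T (Sum.inl false)) +
      ∑ m : Fin r, ∑ a : Fin (n m), (if π m a ∈ P m then ((cnt v T (Sum.inr ⟨m, (a, true)⟩) : ℤ) - cnt v T (Sum.inr ⟨m, (a, false)⟩))
        else -(((cnt v T (Sum.inr ⟨m, (a, true)⟩)) : ℤ) - cnt v T (Sum.inr ⟨m, (a, false)⟩))) = 0 := fun π' hπ' =>
    signed_transfer (d := fun m a => ((cnt v T (Sum.inr ⟨m, (a, true)⟩)) : ℤ) - cnt v T (Sum.inr ⟨m, (a, false)⟩)) hmul hne htrans hstab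
      (fun π hπ => signed_of_modelBalancedG R v hT hπ) π' ((hmemR' π').1 hπ')
  -- every slot is moved ALONE inside `R'`, through its whole image: the defects are constant slot by slot
  have hupd : ∀ (m₀ : Fin r) (π : PermsG n), π ∈ R → Function.update (1 : PermsG n) m₀ (π m₀) ∈ R' := fun m₀ π hπ =>
    (hmemR' _).2 fun m => by
      by_cases hm : m = m₀
      · subst hm
        exact ⟨π, hπ, by rw [Function.update_self]⟩
      · exact ⟨1, h1R, by rw [Function.update_of_ne hm]⟩
  have hconst : ∀ (m : Fin r) (a b : Fin (n m)), ((cnt v T (Sum.inr ⟨m, (a, true)⟩)) : ℤ) - cnt v T (Sum.inr ⟨m, (a, false)⟩) =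
      ((cnt v T (Sum.inr ⟨m, (b, true)⟩)) : ℤ) - cnt v T (Sum.inr ⟨m, (b, false)⟩) := fun m₀ =>
    hsep m₀ (fun a => ((cnt v T (Sum.inr ⟨m₀, (a, true)⟩)) : ℤ) - cnt v T (Sum.inr ⟨m₀, (a, false)⟩)) fun π hπ =>
      sum_preG_eq_of_signed_update (d := fun m a => ((cnt v T (Sum.inr ⟨m, (a, true)⟩)) : ℤ) - cnt v T (Sum.inr ⟨m, (a, false)⟩)) h1R' (hupd m₀ π hπ) hsig
  obtain ⟨t, hd, he⟩ := exists_defects_of_const (P := P) hne' hconst hsig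
  refine ⟨t, fun m a => hd m a, ?_⟩
  rw [he]
  exact Finset.sum_congr rfl fun m _ => by rw [hc m]

/-! ## §3 Separating slots: prime size; one-member position sets; homogeneous images -/

/-- **A PRIME SLOT SEPARATES EVERY PROPER NON-EMPTY POSITION SET.**  `R` closed under products and inverses, non-empty, transitive on the slot `m` of PRIME size
`n_m`, `0 < |P_m| < n_m`: `R` contains a tuple whose `m`-component has order `n_m` (V1's `exists_orderOf_eq_of_trivial_on`), a conjugate rotation; the sums through its
powers' translates already force constancy (`sep_of_conj_rotate_prime`, cyclotomic). [cite: DixonMortimer1996, §1.6 and §2.1] -/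
theorem sep_of_prime_slot (hmul : ∀ π ∈ R, ∀ π' ∈ R, π * π' ∈ R) (hinv : ∀ π ∈ R, π⁻¹ ∈ R) (hne : R.Nonempty) {m : Fin r} (hp : (n m).Prime)
    (htrans : ∀ a a' : Fin (n m), ∃ π ∈ R, π m a = a') (hP0 : (P m).Nonempty) (hPn : (P m).card < n m)
    (f : Fin (n m) → ℤ) (h : ∀ π ∈ R, ∑ a ∈ preG (π m) (P m), f a = ∑ a ∈ P m, f a) (a b : Fin (n m)) : f a = f b := by
  have h1R : (1 : PermsG n) ∈ R := one_mem_of_closed hmul hinv hne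
  -- a tuple non-trivial at `m`, then one of order `n m` there
  have h2 := hp.two_le
  obtain ⟨π₁, hπ₁, hmove⟩ := htrans ⟨0, by omega⟩ ⟨1, by omega⟩
  have hσ : π₁ m ≠ 1 := fun h1 => by
    rw [h1, Equiv.Perm.one_apply] at hmove
    exact absurd (congrArg Fin.val hmove) (by simp)
  obtain ⟨ρ, hρ, -, hord⟩ := exists_orderOf_eq_of_trivial_on hmul hinv hne hp htrans ∅ ⟨π₁, hπ₁, fun _ hm => absurd hm (Finset.notMem_empty _), hσ⟩
  obtain ⟨g, hg⟩ := exists_conj_finRotate_of_orderOf_eq_prime hp (ρ m) hord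
  refine sep_of_conj_rotate_prime hp 1 g hP0 hPn f (fun j => ?_) a b
  rw [hg, one_mul, preG_one, ← Pi.pow_apply]
  exact h _ (by rw [← one_mul (ρ ^ j)]; exact mul_pow_mem hmul h1R hρ j)

/-- **A ONE-MEMBER POSITION SET IS SEPARATED BY ANY TRANSITIVE IMAGE** (any slot size): `P_m = {p}`; for every position `a` some tuple carries `a` to `p`, so the
translate `{a}` occurs and `f a = f p`. [cite: DixonMortimer1996, §1.6] -/
theorem sep_of_card_one {m : Fin r} (htrans : ∀ a a' : Fin (n m), ∃ π ∈ R, π m a = a') (hP1 : (P m).card = 1)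
    (f : Fin (n m) → ℤ) (h : ∀ π ∈ R, ∑ a ∈ preG (π m) (P m), f a = ∑ a ∈ P m, f a) (a b : Fin (n m)) : f a = f b := by
  obtain ⟨p, hp⟩ := Finset.card_eq_one.1 hP1
  have hval : ∀ a : Fin (n m), f a = f p := fun a => by
    obtain ⟨π, hπ, hπa⟩ := htrans a p
    have hpre : preG (π m) (P m) = {a} := by
      ext x
      rw [mem_preG, hp, Finset.mem_singleton, Finset.mem_singleton, ← hπa]
      exact (π m).injective.eq_iff
    have := h π hπ
    rwa [hpre, hp, Finset.sum_singleton, Finset.sum_singleton] at this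
  rw [hval a, hval b]

/-- **A HOMOGENEOUS IMAGE SEPARATES**: `0 < |P_m| < n_m` and every `|P_m|`-subset of the slot is a translate `(π_m)⁻¹ P_m`, `π ∈ R` (`|P_m|`-homogeneous image): equal
sums through all `|P_m|`-subsets force constancy (`sep_of_powersetCard`). [cite: DixonMortimer1996, §2.1] -/
theorem sep_of_homogeneous {m : Fin r} (hP0 : 0 < (P m).card) (hPn : (P m).card < n m)
    (hhom : ∀ Q : Finset (Fin (n m)), Q.card = (P m).card → ∃ π ∈ R, preG (π m) (P m) = Q)
    (f : Fin (n m) → ℤ) (h : ∀ π ∈ R, ∑ a ∈ preG (π m) (P m), f a = ∑ a ∈ P m, f a) (a b : Fin (n m)) : f a = f b :=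
  sep_of_powersetCard hP0 hPn (𝒳 := (Finset.univ : Finset (Finset (Fin (n m)))).filter fun Q => Q.card = (P m).card)
    (fun Q hQ => Finset.mem_filter.2 ⟨Finset.mem_univ _, hQ⟩) f (fun Q hQ => by
      obtain ⟨π, hπ, hπQ⟩ := hhom Q (Finset.mem_filter.1 hQ).2
      rw [← hπQ]
      exact h π hπ) a b

/-- **ORDERED `2`-TRANSITIVITY GIVES `2`-HOMOGENEITY**: if `R` moves every ordered pair of distinct positions of the slot `m` to every other, then every `2`-subset is a
translate of the `2`-element position set `P_m`. [cite: DixonMortimer1996, §2.1] -/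
theorem homogeneous_two_of_twoTransitive {m : Fin r} (hP2 : (P m).card = 2)
    (h2t : ∀ a b a' b' : Fin (n m), a ≠ b → a' ≠ b' → ∃ π ∈ R, π m a = a' ∧ π m b = b')
    (Q : Finset (Fin (n m))) (hQ : Q.card = (P m).card) : ∃ π ∈ R, preG (π m) (P m) = Q := by
  obtain ⟨p, q, hpq, hP⟩ := Finset.card_eq_two.1 hP2
  obtain ⟨a, b, hab, hQab⟩ := Finset.card_eq_two.1 (hQ.trans hP2)
  obtain ⟨π, hπ, hπa, hπb⟩ := h2t a b p q hab hpq
  refine ⟨π, hπ, (Finset.eq_of_subset_of_card_le (fun x hx => ?_) (by rw [card_preG, hQ])).symm⟩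
  rw [hQab, Finset.mem_insert, Finset.mem_singleton] at hx
  rw [mem_preG, hP, Finset.mem_insert, Finset.mem_singleton]
  rcases hx with rfl | rfl
  · exact Or.inl hπa
  · exact Or.inr hπb

/-- **THE SLOT MENU.**  A slot separates its position set if it is of one of three kinds: PRIME size with a proper non-empty position set; a ONE-member position set;
or a proper non-empty position set with HOMOGENEOUS image. [cite: DixonMortimer1996, §1.6 and §2.1] -/
theorem sep_of_kind (hmul : ∀ π ∈ R, ∀ π' ∈ R, π * π' ∈ R) (hinv : ∀ π ∈ R, π⁻¹ ∈ R) (hne : R.Nonempty) {m : Fin r}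
    (htrans : ∀ a a' : Fin (n m), ∃ π ∈ R, π m a = a')
    (hkind : ((n m).Prime ∧ (P m).Nonempty ∧ (P m).card < n m) ∨ (P m).card = 1 ∨
      ((0 < (P m).card ∧ (P m).card < n m) ∧ ∀ Q : Finset (Fin (n m)), Q.card = (P m).card → ∃ π ∈ R, preG (π m) (P m) = Q))
    (f : Fin (n m) → ℤ) (h : ∀ π ∈ R, ∑ a ∈ preG (π m) (P m), f a = ∑ a ∈ P m, f a) (a b : Fin (n m)) : f a = f b := by
  rcases hkind with ⟨hp, hP0, hPn⟩ | hP1 | ⟨⟨hP0, hPn⟩, hhom⟩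
  · exact sep_of_prime_slot hmul hinv hne hp htrans hP0 hPn f h a b
  · exact sep_of_card_one htrans hP1 f h a b
  · exact sep_of_homogeneous hP0 hPn hhom f h a b

/-- **THE DEFECT LAW FOR THE SLOT MENU** (stabiliser-transitive `R`; each slot prime ∕ one-member ∕ homogeneous). [cite: MoonenZarhin1995Duke, Thm. 2.4] [cite: Pohlmann1968, Thm 1]
[cite: DixonMortimer1996, §1.6 Thm. 1.6A, §2.1] -/
theorem exists_hasDefectsG_of_stabiliserTransitive_kind (hmul : ∀ π ∈ R, ∀ π' ∈ R, π * π' ∈ R) (hinv : ∀ π ∈ R, π⁻¹ ∈ R) (hne : R.Nonempty)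
    (htrans : ∀ (m : Fin r) (a a' : Fin (n m)), ∃ π ∈ R, π m a = a')
    (hstab : ∀ (m₀ m : Fin r), m₀ ≠ m → ∀ a a' : Fin (n m), ∃ ν ∈ R, ν m₀ = 1 ∧ ν m a = a')
    (hkind : ∀ m : Fin r, ((n m).Prime ∧ (P m).Nonempty ∧ (P m).card < n m) ∨ (P m).card = 1 ∨
      ((0 < (P m).card ∧ (P m).card < n m) ∧ ∀ Q : Finset (Fin (n m)), Q.card = (P m).card → ∃ π ∈ R, preG (π m) (P m) = Q))
    (c : Fin r → ℕ) (hc : ∀ m, ((c m : ℕ) : ℤ) = (n m : ℤ) - 2 * (P m).card)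
    {α : Type} (v : α → PtG n) (T : Finset α) (hT : ModelBalancedG P R v T) : ∃ t : Fin r → ℤ, HasDefectsG c v T t :=
  exists_hasDefectsG_of_stabiliserTransitive_sep hmul hinv hne htrans hstab (fun m f h => sep_of_kind hmul hinv hne (htrans m) (hkind m) f h) c hc v T hT

end Model

/-! ## §4 Realised tuples -/

section Realised

variable {I : Type} {r : ℕ} {Kf : I → Type} [∀ i, Field (Kf i)] [∀ i, NumberField (Kf i)] {i₀ : I} {is : Fin r → I} {n : Fin r → ℕ}
  {e : ∀ m : Fin r, (Kf (is m) →+* ℂ) ≃ Fin (n m) × Bool} {τ : Kf i₀ →+* ℂ} {im : ∀ m : Fin r, Kf i₀ →+* Kf (is m)}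
  (he_sign : ∀ (m : Fin r) (s : Kf (is m) →+* ℂ), (e m s).2 = true ↔ s.comp (im m) = τ)

include he_sign in
/-- **THE DEFECT LAW FOR STABILISER-TRANSITIVE REALISED TUPLES, SLOT MENU** (no primality): frames `e_m` on CM fields `K_m ⊇ i_m(k)`; for `m₀ ≠ m` the realised tuples
trivial at `m₀` transitive on the slot `m`; each slot of PRIME size with `0 < |P_m| < n_m`, OR with `|P_m| = 1` (e.g. `(1,3)`-octics), OR with `0 < |P_m| < n_m` and a
`|P_m|`-homogeneous realised image (e.g. `(2,2)`-octics with `2`-transitive quartic part, `homogeneous_two_of_twoTransitive`).  Then every configuration balanced under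
the realised tuples obeys the defect law. [cite: MoonenZarhin1995Duke, Thm. 2.4] [cite: Shimura1998, §18.2 Lemma (i)] [cite: DixonMortimer1996, §1.6 Thm. 1.6A, §2.1] -/
theorem exists_hasDefectsG_realisedTuples_of_stabiliserTransitive_kind
    (hstab : ∀ (m₀ m : Fin r), m₀ ≠ m → ∀ a a' : Fin (n m), ∃ ν ∈ realisedTuples e τ, ν m₀ = 1 ∧ ν m a = a')
    {P : ∀ m : Fin r, Finset (Fin (n m))}
    (hkind : ∀ m : Fin r, ((n m).Prime ∧ (P m).Nonempty ∧ (P m).card < n m) ∨ (P m).card = 1 ∨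
      ((0 < (P m).card ∧ (P m).card < n m) ∧ ∀ Q : Finset (Fin (n m)), Q.card = (P m).card → ∃ π ∈ realisedTuples e τ, preG (π m) (P m) = Q))
    (c : Fin r → ℕ) (hc : ∀ m, ((c m : ℕ) : ℤ) = (n m : ℤ) - 2 * (P m).card)
    {α : Type} (v : α → PtG n) (T : Finset α) (hT : ModelBalancedG P (realisedTuples e τ) v T) : ∃ t : Fin r → ℤ, HasDefectsG c v T t :=
  exists_hasDefectsG_of_stabiliserTransitive_kind (fun _ hπ _ hπ' => mul_mem_realisedTuples e τ hπ hπ') (fun _ hπ => inv_mem_realisedTuples hπ)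
    (realisedTuples_nonempty (e := e) he_sign) (fun m a b => transitive_realisedTuples (e := e) he_sign m a b) hstab hkind c hc v T hT

end Realised

end Summit.HodgeConjecture.CorCM.MultiFieldWeil

end
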